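import Summits.SmoothPoincare4.SmoothPoincare4.Theorems.SoloInformedPretzelSurgeryTietze23
import Summits.SmoothPoincare4.SmoothPoincare4.Theorems.SoloInformedPretzelSurgeryOrder

/-!
# `|π₁(S³₂₃(P(-2,3,9)))| = 2760` from nine word identities (product-structure glue, slope `23`)

The slope-`23` companion of `SoloInformedPretzelSurgeryOrder`: `SoloInformedPretzelSurgeryQuotients` proves
`ρ23 : G23 = π₁(S³₂₃(P(-2,3,9))) → ℤ/23 × SL(2,𝔽₅)` onto and `bijective_ρ23_of_card_le : [Finite G23] →
Nat.card G23 ≤ 2760 → Bijective ρ23`; here the opaque upper bound is replaced by nine explicit identities among short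
words in the Wirtinger generators `a₀, …, a₁₃`, which force `Finite G23`, `Nat.card G23 = 2760` and
`G23 ≃* ℤ/23 × SL(2,𝔽₅)` by the same structural argument:

* `x = a₂a₄⁻¹`, `y = a₁a₄⁻¹`, `z = a₁a₀⁻¹` satisfy `x² = y³ = z⁵ = xyz`, so `K = ⟨x, y, z⟩` is an image of `⟨2,3,5⟩`,
  of order `≤ 120` (`BinaryIcosahedralOrder.card_le`);
* the meridian `μ = a₁₁` conjugates `x, y, z` into words in `x, y, z`, and `μ²³ = zy⁻¹z⁻¹x ∈ K`, so `K` is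
  `μ^{±1}`-invariant and `⟨μ⟩K = {μⁿk : n < 23, k ∈ K}`;
* `a₀ = xy⁻¹μ`, `a₁₀ = z⁻¹xzy⁻¹μ`, and `a₀, a₁₀, a₁₁` generate `G23` (`σ23_surjective`), so `|G23| ≤ 23 · 120 = 2760`.

The identities hold in `G23` (`nine_ρ23`: their `ρ23`-images agree, and `ρ23` is injective by the coset enumeration of
(L2), `work/s110/certs/pretzel_m2_3_9_slope23.json`); they are the word problems a kernel certificate would have to fill.
-/

namespace Summit.SmoothPoincare4.SmoothPoincare4.Theorems
namespace PretzelSurgery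

open Literature.Algebra.Homology.RelationModule

/-- `x = a₂a₄⁻¹` (order-`4` image in `SL(2,𝔽₅)`). -/
def xJ : G23 := g23 2 * (g23 4)⁻¹
/-- `y = a₁a₄⁻¹` (order `6`). -/
def yJ : G23 := g23 1 * (g23 4)⁻¹
/-- `z = a₁a₀⁻¹` (order `10`, `XYZ = -1`). -/
def zJ : G23 := g23 1 * (g23 0)⁻¹
/-- The meridian `μ = a₁₁` (`mu11`). -/
def mu11 : G23 := g23 11

/-- The nine word identities for slope `23` (all true in `G23`; see the module docstring). -/
structure NineIdentities23 : Prop where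
  /-- `x² = xyz`. -/
  relX : xJ ^ 2 = xJ * yJ * zJ
  /-- `y³ = xyz`. -/
  relY : yJ ^ 3 = xJ * yJ * zJ
  /-- `z⁵ = xyz`. -/
  relZ : zJ ^ 5 = xJ * yJ * zJ
  /-- `μxμ⁻¹ = yxy⁻¹z⁻¹xzy`. -/
  conjX : mu11 * xJ * mu11⁻¹ = yJ * xJ * yJ⁻¹ * zJ⁻¹ * xJ * zJ * yJ
  /-- `μyμ⁻¹ = zy⁻¹z⁻¹xy⁻¹`. -/
  conjY : mu11 * yJ * mu11⁻¹ = zJ * yJ⁻¹ * zJ⁻¹ * xJ * yJ⁻¹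
  /-- `μzμ⁻¹ = zzy⁻¹`. -/
  conjZ : mu11 * zJ * mu11⁻¹ = zJ * zJ * yJ⁻¹
  /-- `μ²³ = zy⁻¹z⁻¹x`. -/
  pow23 : mu11 ^ 23 = zJ * yJ⁻¹ * zJ⁻¹ * xJ
  /-- `a₀ = xy⁻¹μ`. -/
  arc0 : g23 0 = xJ * yJ⁻¹ * mu11
  /-- `a₁₀ = z⁻¹xzy⁻¹μ`. -/
  arc10 : g23 10 = zJ⁻¹ * xJ * zJ * yJ⁻¹ * mu11

/-- Sanity check: the nine identities hold after `ρ23`. -/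
theorem nine_ρ23 :
    ρ23 xJ ^ 2 = ρ23 xJ * ρ23 yJ * ρ23 zJ ∧ ρ23 yJ ^ 3 = ρ23 xJ * ρ23 yJ * ρ23 zJ ∧
    ρ23 zJ ^ 5 = ρ23 xJ * ρ23 yJ * ρ23 zJ ∧
    ρ23 mu11 * ρ23 xJ * (ρ23 mu11)⁻¹ = ρ23 yJ * ρ23 xJ * (ρ23 yJ)⁻¹ * (ρ23 zJ)⁻¹ * ρ23 xJ * ρ23 zJ * ρ23 yJ ∧
    ρ23 mu11 * ρ23 yJ * (ρ23 mu11)⁻¹ = ρ23 zJ * (ρ23 yJ)⁻¹ * (ρ23 zJ)⁻¹ * ρ23 xJ * (ρ23 yJ)⁻¹ ∧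
    ρ23 mu11 * ρ23 zJ * (ρ23 mu11)⁻¹ = ρ23 zJ * ρ23 zJ * (ρ23 yJ)⁻¹ ∧
    ρ23 mu11 ^ 23 = ρ23 zJ * (ρ23 yJ)⁻¹ * (ρ23 zJ)⁻¹ * ρ23 xJ ∧
    ρ23 (g23 0) = ρ23 xJ * (ρ23 yJ)⁻¹ * ρ23 mu11 ∧
    ρ23 (g23 10) = (ρ23 zJ)⁻¹ * ρ23 xJ * ρ23 zJ * (ρ23 yJ)⁻¹ * ρ23 mu11 := by
  simp only [xJ, yJ, zJ, mu11, g23, map_mul, map_inv, ρ23_of]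
  decide +kernel

/-- The generator assignment of `⟨2,3,5⟩` into `G23`. -/
def icoGen23 : Fin 3 → G23 := ![xJ, yJ, zJ]

/-- Under `relX, relY, relZ` the relators of `⟨2,3,5⟩` are killed. -/
theorem lift_icoGen23 (h : NineIdentities23) : ∀ r ∈ binaryTriangleRels 2 3 5, FreeGroup.lift icoGen23 r = 1 := by
  rintro r ⟨i, rfl⟩
  fin_cases i
  · simp only [powRelWord, xyzWord, triExp, map_mul, map_inv, map_pow, FreeGroup.lift_apply_of, icoGen23]
    simp only [Fin.zero_eta, Matrix.cons_val_zero, Matrix.cons_val_one, Matrix.cons_val, mul_inv_eq_one]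
    exact h.relX
  · simp only [powRelWord, xyzWord, triExp, map_mul, map_inv, map_pow, FreeGroup.lift_apply_of, icoGen23]
    simp only [Matrix.cons_val_zero, Fin.mk_one, Matrix.cons_val_one, Matrix.cons_val, mul_inv_eq_one]
    exact h.relY
  · simp only [powRelWord, xyzWord, triExp, map_mul, map_inv, map_pow, FreeGroup.lift_apply_of, icoGen23]
    simp only [Matrix.cons_val_zero, Matrix.cons_val_one, Matrix.cons_val, Fin.reduceFinMk, mul_inv_eq_one]
    exact h.relZ

/-- `ψ : ⟨2,3,5⟩ →* G23` (`psi23`). -/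
def psi23 (h : NineIdentities23) : B235 →* G23 := PresentedGroup.toGroup (lift_icoGen23 h)

/-- `psi23` on generators. -/
theorem psi23_of (h : NineIdentities23) (i : Fin 3) : psi23 h (PresentedGroup.of i) = icoGen23 i :=
  PresentedGroup.toGroup.of _

/-- **Main theorem (slope 23).** The nine identities force `Finite G23` and `|G23| ≤ 2760`. -/
theorem finite_and_card_of_nine23 (h : NineIdentities23) : Finite G23 ∧ Nat.card G23 ≤ 2760 := by
  set K : Subgroup G23 := (psi23 h).range with hKdef
  have hx : xJ ∈ K := ⟨PresentedGroup.of 0, psi23_of h 0⟩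
  have hy : yJ ∈ K := ⟨PresentedGroup.of 1, psi23_of h 1⟩
  have hz : zJ ∈ K := ⟨PresentedGroup.of 2, psi23_of h 2⟩
  haveI : Finite B235 := BinaryIcosahedralOrder.finite
  haveI hKfin : Finite K := Finite.of_surjective _ (psi23 h).rangeRestrict_surjective
  have hKcard : Nat.card K ≤ 120 :=
    (Nat.card_le_card_of_surjective _ (psi23 h).rangeRestrict_surjective).trans BinaryIcosahedralOrder.card_le
  have hconj : ∀ k ∈ K, mu11 * k * mu11⁻¹ ∈ K := by
    have hgen : ∀ i : Fin 3, (PresentedGroup.of i : B235) ∈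
        K.comap ((MulAut.conj mu11).toMonoidHom.comp (psi23 h)) := by
      intro i
      simp only [Subgroup.mem_comap, MonoidHom.coe_comp, MulEquiv.coe_toMonoidHom, Function.comp_apply,
        MulAut.conj_apply, psi23_of, icoGen23]
      fin_cases i
      · simp only [Fin.zero_eta, Matrix.cons_val_zero, h.conjX]
        exact K.mul_mem (K.mul_mem (K.mul_mem (K.mul_mem (K.mul_mem (K.mul_mem hy hx) (K.inv_mem hy))
          (K.inv_mem hz)) hx) hz) hy
      · simp only [Fin.mk_one, Matrix.cons_val_one, Matrix.cons_val_zero, h.conjY]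
        exact K.mul_mem (K.mul_mem (K.mul_mem (K.mul_mem hz (K.inv_mem hy)) (K.inv_mem hz)) hx) (K.inv_mem hy)
      · simp only [Fin.reduceFinMk, Matrix.cons_val, h.conjZ]
        exact K.mul_mem (K.mul_mem hz hz) (K.inv_mem hy)
    rintro k ⟨b, rfl⟩
    have hb := PresentedGroup.generated_by _ _ hgen b
    simpa only [Subgroup.mem_comap, MonoidHom.coe_comp, MulEquiv.coe_toMonoidHom, Function.comp_apply,
      MulAut.conj_apply] using hb
  have hconj_pow : ∀ n : ℕ, ∀ k ∈ K, mu11 ^ n * k * (mu11 ^ n)⁻¹ ∈ K := by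
    intro n
    induction n with
    | zero => intro k hk; simpa using hk
    | succ n ih =>
      intro k hk
      have e : mu11 ^ (n + 1) * k * (mu11 ^ (n + 1))⁻¹ = mu11 * (mu11 ^ n * k * (mu11 ^ n)⁻¹) * mu11⁻¹ := by
        rw [pow_succ']; group
      rw [e]; exact hconj _ (ih k hk)
  have h23 : mu11 ^ 23 ∈ K := by
    rw [h.pow23]; exact K.mul_mem (K.mul_mem (K.mul_mem hz (K.inv_mem hy)) (K.inv_mem hz)) hx
  have hconj' : ∀ k ∈ K, mu11⁻¹ * k * mu11 ∈ K := by
    intro k hk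
    have e : mu11⁻¹ * k * mu11 = mu11 ^ 22 * ((mu11 ^ 23)⁻¹ * k * mu11 ^ 23) * (mu11 ^ 22)⁻¹ := by group
    rw [e]; exact hconj_pow 22 _ (K.mul_mem (K.mul_mem (K.inv_mem h23) hk) h23)
  have hconj'_pow : ∀ n : ℕ, ∀ k ∈ K, (mu11 ^ n)⁻¹ * k * mu11 ^ n ∈ K := by
    intro n
    induction n with
    | zero => intro k hk; simpa using hk
    | succ n ih =>
      intro k hk
      have e : (mu11 ^ (n + 1))⁻¹ * k * mu11 ^ (n + 1) = mu11⁻¹ * ((mu11 ^ n)⁻¹ * k * mu11 ^ n) * mu11 := by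
        rw [pow_succ]; group
      rw [e]; exact hconj' _ (ih k hk)
  let P : G23 → Prop := fun g => ∃ n : ℕ, ∃ k ∈ K, g = mu11 ^ n * k
  have P1 : P 1 := ⟨0, 1, K.one_mem, by simp⟩
  have Pμ : ∀ g, P g → P (mu11 * g) := by
    rintro g ⟨n, k, hk, rfl⟩; exact ⟨n + 1, k, hk, by rw [pow_succ']; group⟩
  have Pμ' : ∀ g, P g → P (mu11⁻¹ * g) := by
    rintro g ⟨n, k, hk, rfl⟩
    refine ⟨n + 22, (mu11 ^ 23)⁻¹ * k, K.mul_mem (K.inv_mem h23) hk, ?_⟩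
    rw [pow_add]; group
  have PK : ∀ k' ∈ K, ∀ g, P g → P (k' * g) := by
    rintro k' hk' g ⟨n, k, hk, rfl⟩
    refine ⟨n, (mu11 ^ n)⁻¹ * k' * mu11 ^ n * k, K.mul_mem (hconj'_pow n k' hk') hk, ?_⟩
    group
  have PKinv : ∀ k' ∈ K, ∀ g, P g → P (k'⁻¹ * g) := fun k' hk' g hg => PK _ (K.inv_mem hk') g hg
  have hw0 : xJ * yJ⁻¹ ∈ K := K.mul_mem hx (K.inv_mem hy)
  have hw10 : zJ⁻¹ * xJ * zJ * yJ⁻¹ ∈ K := K.mul_mem (K.mul_mem (K.mul_mem (K.inv_mem hz) hx) hz) (K.inv_mem hy)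
  have Pall : ∀ g ∈ Subgroup.closure ({g23 0, g23 10, g23 11} : Set G23), P g := by
    intro g hg
    refine Subgroup.closure_induction_left (p := fun g _ => P g) P1 ?_ ?_ hg
    · rintro a ha g - hPg
      simp only [Set.mem_insert_iff, Set.mem_singleton_iff] at ha
      rcases ha with rfl | rfl | rfl
      · rw [h.arc0, mul_assoc]; exact PK _ hw0 _ (Pμ _ hPg)
      · rw [h.arc10, mul_assoc]; exact PK _ hw10 _ (Pμ _ hPg)
      · exact Pμ _ hPg
    · rintro a ha g - hPg
      simp only [Set.mem_insert_iff, Set.mem_singleton_iff] at ha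
      rcases ha with rfl | rfl | rfl
      · rw [h.arc0, mul_inv_rev, mul_assoc]; exact Pμ' _ (PKinv _ hw0 _ hPg)
      · rw [h.arc10, mul_inv_rev, mul_assoc]; exact Pμ' _ (PKinv _ hw10 _ hPg)
      · exact Pμ' _ hPg
  have htop : ∀ g : G23, g ∈ Subgroup.closure ({g23 0, g23 10, g23 11} : Set G23) := by
    intro g
    obtain ⟨b, rfl⟩ := σ23_surjective g
    have hgen : ∀ i : Fin 3, (PresentedGroup.of i : G23c) ∈
        (Subgroup.closure ({g23 0, g23 10, g23 11} : Set G23)).comap σ23 := by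
      intro i
      rw [Subgroup.mem_comap, show σ23 (PresentedGroup.of i) = kept23 i from PresentedGroup.toGroup.of _]
      apply Subgroup.subset_closure
      fin_cases i <;> simp [kept23]
    exact PresentedGroup.generated_by _ _ hgen b
  let f : Fin 23 × K → G23 := fun p => mu11 ^ (p.1 : ℕ) * p.2
  have hf : Function.Surjective f := by
    intro g
    obtain ⟨n, k, hk, rfl⟩ := Pall g (htop g)
    refine ⟨(⟨n % 23, Nat.mod_lt _ (by norm_num)⟩, ⟨(mu11 ^ 23) ^ (n / 23) * k, K.mul_mem (K.pow_mem h23 _) hk⟩), ?_⟩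
    show mu11 ^ (n % 23) * ((mu11 ^ 23) ^ (n / 23) * k) = mu11 ^ n * k
    rw [← mul_assoc, ← pow_mul, ← pow_add, Nat.mod_add_div]
  haveI : Finite G23 := Finite.of_surjective f hf
  refine ⟨inferInstance, ?_⟩
  calc Nat.card G23 ≤ Nat.card (Fin 23 × K) := Nat.card_le_card_of_surjective f hf
    _ = 23 * Nat.card K := by rw [Nat.card_prod, Nat.card_eq_fintype_card, Fintype.card_fin]
    _ ≤ 23 * 120 := Nat.mul_le_mul_left _ hKcard

/-- **`|π₁(S³₂₃(P(-2,3,9)))| = 2760` and `ρ23` is an isomorphism**, given the nine identities. -/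
theorem card_eq_and_bijective_of_nine23 (h : NineIdentities23) :
    Nat.card G23 = 2760 ∧ Function.Bijective ρ23 := by
  obtain ⟨hfin, hle⟩ := finite_and_card_of_nine23 h
  haveI := hfin
  exact ⟨le_antisymm hle le_card_G23, bijective_ρ23_of_card_le hle⟩

/-- The isomorphism `G23 ≃* ℤ/23 × SL(2,𝔽₅)`, given the nine identities. -/
noncomputable def mulEquivK23_of_nine (h : NineIdentities23) : G23 ≃* K23 :=
  MulEquiv.ofBijective ρ23 (card_eq_and_bijective_of_nine23 h).2

/-- Conversely the nine identities follow from injectivity of `ρ23` (their images agree, `nine_ρ23`). -/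
theorem nine23_of_injective (h : Function.Injective ρ23) : NineIdentities23 := by
  obtain ⟨h1, h2, h3, h4, h5, h6, h7, h8, h9⟩ := nine_ρ23
  refine ⟨h ?_, h ?_, h ?_, h ?_, h ?_, h ?_, h ?_, h ?_, h ?_⟩
  · simp only [map_mul, map_pow]; exact h1
  · simp only [map_mul, map_pow]; exact h2
  · simp only [map_mul, map_pow]; exact h3
  · simp only [map_mul, map_inv]; exact h4
  · simp only [map_mul, map_inv]; exact h5
  · simp only [map_mul, map_inv]; exact h6
  · simp only [map_mul, map_inv, map_pow]; exact h7
  · simp only [map_mul, map_inv]; exact h8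
  · simp only [map_mul, map_inv]; exact h9

/-- **The nine identities are exactly the content of the upper bound:** `ρ23` is an isomorphism iff they hold. -/
theorem bijective_ρ23_iff_nine : Function.Bijective ρ23 ↔ NineIdentities23 :=
  ⟨fun h => nine23_of_injective h.1, fun h => (card_eq_and_bijective_of_nine23 h).2⟩

end PretzelSurgery
end Summit.SmoothPoincare4.SmoothPoincare4.Theorems
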